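import Summits.Ventures.WeilGRH.UniformConductorFloorCellsBudget
import Summits.Ventures.WeilGRH.UniformConductorFloorCellsOne
import Summits.Ventures.WeilGRH.UniformConductorFloorCellsDataEighty
import Summits.Ventures.WeilGRH.RungLogBounds
import HarnessLib

/-!
# GRH arm (rh-explicit, venture WeilGRH): the `J = 80` certificate at `t = 1` — shifts, `φ` bounds, cells 0–19

Cell `rh-explicit`, WEIL TRACK — GRH ARM (weil-grh-1).  The `t = 1` cell certificate refined to `J = 80` cells (`δ = 1/40`,
shift indices `s_n = 27, 43, 55, 64, 77` at `n = 2, 3, 4, 5, 7`, `φ = phiOne80` of `UniformConductorFloorCellsDataEighty.lean`,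
**`ρ = 2.0866`** against `2.1506` at `J = 40`); one `norm_num` theorem per cell.  

## References

* A. Weil (1952), (11) and the «lemme» p. 262 [Weil1952FormulesExplicites]; H. Yoshida (1992) §2, §6 [Yoshida1992].
-/

noncomputable section

open Complex Filter Set MeasureTheory
open scoped Real Topology ComplexConjugate ArithmeticFunction.vonMangoldt

namespace Summit.Ventures.WeilGRH

open Literature.NumberTheory.LFunctions

namespace UniformFloor

variable {q : ℕ}

/-! ## Shift brackets at `t = 1`, `J = 80` -/

/-- `s_n δ ≤ log n ≤ (s_n + 1)δ`, `δ = 1/40`, `s = 27, 43, 55, 64, 71, 77` at `n = 2, …, 7`. [folklore] -/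
theorem one80_shifts : ∀ n ∈ Finset.range (7 + 1),
    ((sOne80 n : ℤ) : ℝ) * (2 * 1 / ((80 : ℕ) : ℝ)) ≤ Real.log n ∧
      Real.log n ≤ (((sOne80 n : ℤ) : ℝ) + 1) * (2 * 1 / ((80 : ℕ) : ℝ)) := by
  intro n hn
  have hn8 : n < 8 := by have := Finset.mem_range.1 hn; omega
  have h2 := Real.log_two_gt_d9; have h2' := Real.log_two_lt_d9
  have h3 := Real.log_three_gt_d9; have h3' := Real.log_three_lt_d9
  have h5 := Real.log_five_gt_d9; have h5' := Real.log_five_lt_d9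
  have h7 := log_seven_ge; have h7' := log_seven_le
  have e4 : Real.log 4 = 2 * Real.log 2 := by
    rw [show (4 : ℝ) = 2 ^ 2 by norm_num, Real.log_pow]; push_cast; ring
  have e6 : Real.log 6 = Real.log 2 + Real.log 3 := by
    rw [show (6 : ℝ) = 2 * 3 by norm_num, Real.log_mul (by norm_num) (by norm_num)]
  interval_cases n
  · norm_num [sOne80]
  · norm_num [sOne80]
  · norm_num [sOne80]; constructor <;> linarith
  · norm_num [sOne80]; constructor <;> linarith
  · norm_num [sOne80, e4]; constructor <;> linarith
  · norm_num [sOne80]; constructor <;> linarith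
  · norm_num [sOne80, e6]; constructor <;> linarith
  · norm_num [sOne80]; constructor <;> linarith

/-! ## The certificate, cells 0–19 -/
/-- `647/2500 ≤ φ_j` on `[0, 80)`. [folklore] -/
theorem one80_philo : ∀ i : ℤ, 0 ≤ i → i < ((80 : ℕ) : ℤ) → (647 / 2500 : ℝ) ≤ phiOne80 i := by
  intro i h0 h1
  push_cast at h1
  interval_cases i <;> norm_num [phiOne80]

/-- `φ_j ≤ 1`. [folklore] -/
theorem one80_phihi : ∀ i : ℤ, phiOne80 i ≤ (1 : ℝ) := by
  intro i
  by_cases h : 0 ≤ i ∧ i < 80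
  · obtain ⟨h0, h1⟩ := h
    interval_cases i <;> norm_num [phiOne80]
  · simp only [phiOne80, if_neg h]
    norm_num

/-- `φ_j = 0` off `[0, 80)`. [folklore] -/
theorem one80_phiout : ∀ i : ℤ, i < 0 ∨ ((80 : ℕ) : ℤ) ≤ i → phiOne80 i = 0 := by
  intro i hi
  have h : ¬ (0 ≤ i ∧ i < 80) := by omega
  simp only [phiOne80, if_neg h]

/-- Cell `0` of the `one80` certificate (`ρ = 10433/5000`). [folklore] -/
theorem one80_cell_0 :
    ∑ n ∈ Finset.range (7 + 1), wbar7 n *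
      (max (phiOne80 (((0 : ℕ) : ℤ) - sOne80 n - 1)) (phiOne80 (((0 : ℕ) : ℤ) - sOne80 n)) +
        max (phiOne80 (((0 : ℕ) : ℤ) + sOne80 n)) (phiOne80 (((0 : ℕ) : ℤ) + sOne80 n + 1))) ≤
      (10433 / 5000 : ℝ) * phiOne80 ((0 : ℕ) : ℤ) := by
  simp only [Finset.sum_range_succ, Finset.sum_range_zero, wbar7, phiOne80, sOne80]
  norm_num

/-- Cell `1` of the `one80` certificate (`ρ = 10433/5000`). [folklore] -/
theorem one80_cell_1 :
    ∑ n ∈ Finset.range (7 + 1), wbar7 n *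
      (max (phiOne80 (((1 : ℕ) : ℤ) - sOne80 n - 1)) (phiOne80 (((1 : ℕ) : ℤ) - sOne80 n)) +
        max (phiOne80 (((1 : ℕ) : ℤ) + sOne80 n)) (phiOne80 (((1 : ℕ) : ℤ) + sOne80 n + 1))) ≤
      (10433 / 5000 : ℝ) * phiOne80 ((1 : ℕ) : ℤ) := by
  simp only [Finset.sum_range_succ, Finset.sum_range_zero, wbar7, phiOne80, sOne80]
  norm_num

/-- Cell `2` of the `one80` certificate (`ρ = 10433/5000`). [folklore] -/
theorem one80_cell_2 :
    ∑ n ∈ Finset.range (7 + 1), wbar7 n *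
      (max (phiOne80 (((2 : ℕ) : ℤ) - sOne80 n - 1)) (phiOne80 (((2 : ℕ) : ℤ) - sOne80 n)) +
        max (phiOne80 (((2 : ℕ) : ℤ) + sOne80 n)) (phiOne80 (((2 : ℕ) : ℤ) + sOne80 n + 1))) ≤
      (10433 / 5000 : ℝ) * phiOne80 ((2 : ℕ) : ℤ) := by
  simp only [Finset.sum_range_succ, Finset.sum_range_zero, wbar7, phiOne80, sOne80]
  norm_num

/-- Cell `3` of the `one80` certificate (`ρ = 10433/5000`). [folklore] -/
theorem one80_cell_3 :
    ∑ n ∈ Finset.range (7 + 1), wbar7 n *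
      (max (phiOne80 (((3 : ℕ) : ℤ) - sOne80 n - 1)) (phiOne80 (((3 : ℕ) : ℤ) - sOne80 n)) +
        max (phiOne80 (((3 : ℕ) : ℤ) + sOne80 n)) (phiOne80 (((3 : ℕ) : ℤ) + sOne80 n + 1))) ≤
      (10433 / 5000 : ℝ) * phiOne80 ((3 : ℕ) : ℤ) := by
  simp only [Finset.sum_range_succ, Finset.sum_range_zero, wbar7, phiOne80, sOne80]
  norm_num

/-- Cell `4` of the `one80` certificate (`ρ = 10433/5000`). [folklore] -/
theorem one80_cell_4 :
    ∑ n ∈ Finset.range (7 + 1), wbar7 n *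
      (max (phiOne80 (((4 : ℕ) : ℤ) - sOne80 n - 1)) (phiOne80 (((4 : ℕ) : ℤ) - sOne80 n)) +
        max (phiOne80 (((4 : ℕ) : ℤ) + sOne80 n)) (phiOne80 (((4 : ℕ) : ℤ) + sOne80 n + 1))) ≤
      (10433 / 5000 : ℝ) * phiOne80 ((4 : ℕ) : ℤ) := by
  simp only [Finset.sum_range_succ, Finset.sum_range_zero, wbar7, phiOne80, sOne80]
  norm_num

/-- Cell `5` of the `one80` certificate (`ρ = 10433/5000`). [folklore] -/
theorem one80_cell_5 :
    ∑ n ∈ Finset.range (7 + 1), wbar7 n *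
      (max (phiOne80 (((5 : ℕ) : ℤ) - sOne80 n - 1)) (phiOne80 (((5 : ℕ) : ℤ) - sOne80 n)) +
        max (phiOne80 (((5 : ℕ) : ℤ) + sOne80 n)) (phiOne80 (((5 : ℕ) : ℤ) + sOne80 n + 1))) ≤
      (10433 / 5000 : ℝ) * phiOne80 ((5 : ℕ) : ℤ) := by
  simp only [Finset.sum_range_succ, Finset.sum_range_zero, wbar7, phiOne80, sOne80]
  norm_num

/-- Cell `6` of the `one80` certificate (`ρ = 10433/5000`). [folklore] -/
theorem one80_cell_6 :
    ∑ n ∈ Finset.range (7 + 1), wbar7 n *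
      (max (phiOne80 (((6 : ℕ) : ℤ) - sOne80 n - 1)) (phiOne80 (((6 : ℕ) : ℤ) - sOne80 n)) +
        max (phiOne80 (((6 : ℕ) : ℤ) + sOne80 n)) (phiOne80 (((6 : ℕ) : ℤ) + sOne80 n + 1))) ≤
      (10433 / 5000 : ℝ) * phiOne80 ((6 : ℕ) : ℤ) := by
  simp only [Finset.sum_range_succ, Finset.sum_range_zero, wbar7, phiOne80, sOne80]
  norm_num

/-- Cell `7` of the `one80` certificate (`ρ = 10433/5000`). [folklore] -/
theorem one80_cell_7 :
    ∑ n ∈ Finset.range (7 + 1), wbar7 n *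
      (max (phiOne80 (((7 : ℕ) : ℤ) - sOne80 n - 1)) (phiOne80 (((7 : ℕ) : ℤ) - sOne80 n)) +
        max (phiOne80 (((7 : ℕ) : ℤ) + sOne80 n)) (phiOne80 (((7 : ℕ) : ℤ) + sOne80 n + 1))) ≤
      (10433 / 5000 : ℝ) * phiOne80 ((7 : ℕ) : ℤ) := by
  simp only [Finset.sum_range_succ, Finset.sum_range_zero, wbar7, phiOne80, sOne80]
  norm_num

/-- Cell `8` of the `one80` certificate (`ρ = 10433/5000`). [folklore] -/
theorem one80_cell_8 :
    ∑ n ∈ Finset.range (7 + 1), wbar7 n *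
      (max (phiOne80 (((8 : ℕ) : ℤ) - sOne80 n - 1)) (phiOne80 (((8 : ℕ) : ℤ) - sOne80 n)) +
        max (phiOne80 (((8 : ℕ) : ℤ) + sOne80 n)) (phiOne80 (((8 : ℕ) : ℤ) + sOne80 n + 1))) ≤
      (10433 / 5000 : ℝ) * phiOne80 ((8 : ℕ) : ℤ) := by
  simp only [Finset.sum_range_succ, Finset.sum_range_zero, wbar7, phiOne80, sOne80]
  norm_num

/-- Cell `9` of the `one80` certificate (`ρ = 10433/5000`). [folklore] -/
theorem one80_cell_9 :
    ∑ n ∈ Finset.range (7 + 1), wbar7 n *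
      (max (phiOne80 (((9 : ℕ) : ℤ) - sOne80 n - 1)) (phiOne80 (((9 : ℕ) : ℤ) - sOne80 n)) +
        max (phiOne80 (((9 : ℕ) : ℤ) + sOne80 n)) (phiOne80 (((9 : ℕ) : ℤ) + sOne80 n + 1))) ≤
      (10433 / 5000 : ℝ) * phiOne80 ((9 : ℕ) : ℤ) := by
  simp only [Finset.sum_range_succ, Finset.sum_range_zero, wbar7, phiOne80, sOne80]
  norm_num

/-- Cell `10` of the `one80` certificate (`ρ = 10433/5000`). [folklore] -/
theorem one80_cell_10 :
    ∑ n ∈ Finset.range (7 + 1), wbar7 n *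
      (max (phiOne80 (((10 : ℕ) : ℤ) - sOne80 n - 1)) (phiOne80 (((10 : ℕ) : ℤ) - sOne80 n)) +
        max (phiOne80 (((10 : ℕ) : ℤ) + sOne80 n)) (phiOne80 (((10 : ℕ) : ℤ) + sOne80 n + 1))) ≤
      (10433 / 5000 : ℝ) * phiOne80 ((10 : ℕ) : ℤ) := by
  simp only [Finset.sum_range_succ, Finset.sum_range_zero, wbar7, phiOne80, sOne80]
  norm_num

/-- Cell `11` of the `one80` certificate (`ρ = 10433/5000`). [folklore] -/
theorem one80_cell_11 :
    ∑ n ∈ Finset.range (7 + 1), wbar7 n *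
      (max (phiOne80 (((11 : ℕ) : ℤ) - sOne80 n - 1)) (phiOne80 (((11 : ℕ) : ℤ) - sOne80 n)) +
        max (phiOne80 (((11 : ℕ) : ℤ) + sOne80 n)) (phiOne80 (((11 : ℕ) : ℤ) + sOne80 n + 1))) ≤
      (10433 / 5000 : ℝ) * phiOne80 ((11 : ℕ) : ℤ) := by
  simp only [Finset.sum_range_succ, Finset.sum_range_zero, wbar7, phiOne80, sOne80]
  norm_num

/-- Cell `12` of the `one80` certificate (`ρ = 10433/5000`). [folklore] -/
theorem one80_cell_12 :
    ∑ n ∈ Finset.range (7 + 1), wbar7 n *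
      (max (phiOne80 (((12 : ℕ) : ℤ) - sOne80 n - 1)) (phiOne80 (((12 : ℕ) : ℤ) - sOne80 n)) +
        max (phiOne80 (((12 : ℕ) : ℤ) + sOne80 n)) (phiOne80 (((12 : ℕ) : ℤ) + sOne80 n + 1))) ≤
      (10433 / 5000 : ℝ) * phiOne80 ((12 : ℕ) : ℤ) := by
  simp only [Finset.sum_range_succ, Finset.sum_range_zero, wbar7, phiOne80, sOne80]
  norm_num

/-- Cell `13` of the `one80` certificate (`ρ = 10433/5000`). [folklore] -/
theorem one80_cell_13 :
    ∑ n ∈ Finset.range (7 + 1), wbar7 n *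
      (max (phiOne80 (((13 : ℕ) : ℤ) - sOne80 n - 1)) (phiOne80 (((13 : ℕ) : ℤ) - sOne80 n)) +
        max (phiOne80 (((13 : ℕ) : ℤ) + sOne80 n)) (phiOne80 (((13 : ℕ) : ℤ) + sOne80 n + 1))) ≤
      (10433 / 5000 : ℝ) * phiOne80 ((13 : ℕ) : ℤ) := by
  simp only [Finset.sum_range_succ, Finset.sum_range_zero, wbar7, phiOne80, sOne80]
  norm_num

/-- Cell `14` of the `one80` certificate (`ρ = 10433/5000`). [folklore] -/
theorem one80_cell_14 :
    ∑ n ∈ Finset.range (7 + 1), wbar7 n *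
      (max (phiOne80 (((14 : ℕ) : ℤ) - sOne80 n - 1)) (phiOne80 (((14 : ℕ) : ℤ) - sOne80 n)) +
        max (phiOne80 (((14 : ℕ) : ℤ) + sOne80 n)) (phiOne80 (((14 : ℕ) : ℤ) + sOne80 n + 1))) ≤
      (10433 / 5000 : ℝ) * phiOne80 ((14 : ℕ) : ℤ) := by
  simp only [Finset.sum_range_succ, Finset.sum_range_zero, wbar7, phiOne80, sOne80]
  norm_num

/-- Cell `15` of the `one80` certificate (`ρ = 10433/5000`). [folklore] -/
theorem one80_cell_15 :
    ∑ n ∈ Finset.range (7 + 1), wbar7 n *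
      (max (phiOne80 (((15 : ℕ) : ℤ) - sOne80 n - 1)) (phiOne80 (((15 : ℕ) : ℤ) - sOne80 n)) +
        max (phiOne80 (((15 : ℕ) : ℤ) + sOne80 n)) (phiOne80 (((15 : ℕ) : ℤ) + sOne80 n + 1))) ≤
      (10433 / 5000 : ℝ) * phiOne80 ((15 : ℕ) : ℤ) := by
  simp only [Finset.sum_range_succ, Finset.sum_range_zero, wbar7, phiOne80, sOne80]
  norm_num

/-- Cell `16` of the `one80` certificate (`ρ = 10433/5000`). [folklore] -/
theorem one80_cell_16 :
    ∑ n ∈ Finset.range (7 + 1), wbar7 n *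
      (max (phiOne80 (((16 : ℕ) : ℤ) - sOne80 n - 1)) (phiOne80 (((16 : ℕ) : ℤ) - sOne80 n)) +
        max (phiOne80 (((16 : ℕ) : ℤ) + sOne80 n)) (phiOne80 (((16 : ℕ) : ℤ) + sOne80 n + 1))) ≤
      (10433 / 5000 : ℝ) * phiOne80 ((16 : ℕ) : ℤ) := by
  simp only [Finset.sum_range_succ, Finset.sum_range_zero, wbar7, phiOne80, sOne80]
  norm_num

/-- Cell `17` of the `one80` certificate (`ρ = 10433/5000`). [folklore] -/
theorem one80_cell_17 :
    ∑ n ∈ Finset.range (7 + 1), wbar7 n *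
      (max (phiOne80 (((17 : ℕ) : ℤ) - sOne80 n - 1)) (phiOne80 (((17 : ℕ) : ℤ) - sOne80 n)) +
        max (phiOne80 (((17 : ℕ) : ℤ) + sOne80 n)) (phiOne80 (((17 : ℕ) : ℤ) + sOne80 n + 1))) ≤
      (10433 / 5000 : ℝ) * phiOne80 ((17 : ℕ) : ℤ) := by
  simp only [Finset.sum_range_succ, Finset.sum_range_zero, wbar7, phiOne80, sOne80]
  norm_num

/-- Cell `18` of the `one80` certificate (`ρ = 10433/5000`). [folklore] -/
theorem one80_cell_18 :
    ∑ n ∈ Finset.range (7 + 1), wbar7 n *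
      (max (phiOne80 (((18 : ℕ) : ℤ) - sOne80 n - 1)) (phiOne80 (((18 : ℕ) : ℤ) - sOne80 n)) +
        max (phiOne80 (((18 : ℕ) : ℤ) + sOne80 n)) (phiOne80 (((18 : ℕ) : ℤ) + sOne80 n + 1))) ≤
      (10433 / 5000 : ℝ) * phiOne80 ((18 : ℕ) : ℤ) := by
  simp only [Finset.sum_range_succ, Finset.sum_range_zero, wbar7, phiOne80, sOne80]
  norm_num

/-- Cell `19` of the `one80` certificate (`ρ = 10433/5000`). [folklore] -/
theorem one80_cell_19 :
    ∑ n ∈ Finset.range (7 + 1), wbar7 n *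
      (max (phiOne80 (((19 : ℕ) : ℤ) - sOne80 n - 1)) (phiOne80 (((19 : ℕ) : ℤ) - sOne80 n)) +
        max (phiOne80 (((19 : ℕ) : ℤ) + sOne80 n)) (phiOne80 (((19 : ℕ) : ℤ) + sOne80 n + 1))) ≤
      (10433 / 5000 : ℝ) * phiOne80 ((19 : ℕ) : ℤ) := by
  simp only [Finset.sum_range_succ, Finset.sum_range_zero, wbar7, phiOne80, sOne80]
  norm_num
end UniformFloor

end Summit.Ventures.WeilGRH

end
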